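import Literature.MathematicalPhysics.QuantumFieldTheory.FinTorusStackTwistLocality
import Literature.MathematicalPhysics.QuantumFieldTheory.CentralTwistVortexBound
import HarnessLib

/-!
# The strong-coupling bound on 't Hooft's twisted partition function of the ANISOTROPIC box `L_s³ × L_t`, uniform in `L_t`:
# `|ln Z_z(L_s, L_t) - ln Z_1(L_s, L_t)| ≤ 12 · L_s³ L_t · e^{-L_s²}` for `|β| ≤ 1/(4(N+1)·97²e²)`

Topic `Literature/MathematicalPhysics/QuantumFieldTheory`; vocabulary of `AnisotropicTwistedPartitionFunction.lean`
(`twistedPartitionFunctionAniso ρ β L_s L_t z q`, its unfolding `twistedPartitionFunctionAniso_eq_integral`), of `FinTorusPlaquetteSystem.lean`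
/ `FinTorusStackTwistLocality.lean` (the plaquette–link system of the `Fin`-box; twist locality below the area `L_s²`), of the abstract
expansion `PlaquetteSystemTwistAgreement.lean` (`PlaquetteSystem.abs_log_Z_sub_log_Z_le_of_agree`) and of `CentralTwistVortexBound.lean`
(the scalar Wilson-weight estimates `CentralTwist.abs_exp_mul_re_trace_sub_one_le`, `CentralTwist.measurable_exp_mul_re_trace`).
THEOREMS ONLY.  This is the ANISOTROPIC form recorded as missing in `StrongCouplingStringTension.lean`
(`CentralTwist.abs_log_twistZ_sub_log_twistZ_le_pow`: "Symmetric tori only (TODO(general form): `L₃L₄ → ∞` at fixed `L₁L₂` as printed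
in IS08 / Münster's `l → ∞`)") — K. R. Ito, E. Seiler, arXiv:0803.3019 [ItoSeiler2008Further] Thm 2.2 (1); E. T. Tomboulis, arXiv:0707.2179
[Tomboulis2007Confinement] §6.2 (6.10)–(6.12); G. Münster, Nucl. Phys. B180 (1981) 23; G. 't Hooft, Nucl. Phys. B153 (1979) 141 [tHooft1979Flux] §2.

* `tHooft_factor_eq_finTorusStackTwist`, ★ `twistedPartitionFunctionAniso_eq_mul_Z` — BRIDGE: `Z_aniso(z; (0,1); L_s, L_t) =
  e^{-βN·#plaquettes} · Z_{finTorusSystem}(Wilson family twisted by `z·𝟙_{stack(0,0)}`)`; `finTorusStackTwist_one`;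
* ★★ `abs_log_twistedPartitionFunctionAniso_sub_le` — for second-countable compact `G`, continuous `ρ : G →* M_N(ℂ)`, central `z`,
  `|β| ≤ 1/(4(N+1)·97²e²)`, every `L_s ≥ 1`, every `L_t`:  `|ln Z_z - ln Z_1| ≤ 12·L_s³L_t·e^{-L_s²}`.

HONEST FRAMING: strong coupling only; plane `(0,1)` only; the constants `96`/`97` (degree bound) and `12 = 2·6` (anchors = plaquettes)
are crude; nothing about large `β`, vortex free energies at weak coupling, confinement or any limit.  Consumed by the RUNG
`stub_strongCouplingCeiling` of LINE g21-A `MagneticFluxCeiling` (`Summits/…/MagneticFluxCeilingCoulombCeilingStubStrongCouplingCeiling.lean`).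
-/

noncomputable section

open MeasureTheory Finset
open scoped BigOperators

namespace Literature.MathematicalPhysics.QuantumFieldTheory

variable {G : Type*} [Group G] {N : ℕ} (ρ : G →* Matrix (Fin N) (Fin N) ℂ) [TopologicalSpace G]
  [IsTopologicalGroup G] [CompactSpace G] [MeasurableSpace G] [BorelSpace G]

/-! ### The anisotropic twisted partition function as the partition function of a twisted Wilson family -/

section Bridge

variable {Ls Lt : ℕ}

omit [TopologicalSpace G] [IsTopologicalGroup G] [CompactSpace G] [MeasurableSpace G] [BorelSpace G] in
/-- Pointwise form of the Wilson Gibbs factor with insertions (plumbing). [folklore] -/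
private theorem exp_neg_mul_sum_eq_pow_mul_prod (β : ℝ) (s : FinTorusPlaquette Ls Ls Ls Lt → ℝ) :
    Real.exp (-β * ∑ p : FinTorusPlaquette Ls Ls Ls Lt, ((N : ℝ) - s p)) =
      Real.exp (-(β * N)) ^ Fintype.card (FinTorusPlaquette Ls Ls Ls Lt) *
        ∏ p : FinTorusPlaquette Ls Ls Ls Lt, Real.exp (β * s p) := by
  rw [neg_mul, Finset.mul_sum, ← Finset.sum_neg_distrib, Real.exp_sum, ← Finset.card_univ, ← Finset.prod_const,
    ← Finset.prod_mul_distrib]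
  refine Finset.prod_congr rfl fun p _ => ?_
  rw [← Real.exp_add]
  congr 1
  ring

omit [TopologicalSpace G] [IsTopologicalGroup G] [CompactSpace G] [MeasurableSpace G] [BorelSpace G] in
/-- 't Hooft's `(0,1)`-twist factor of `twistedPartitionFunctionAniso_eq_integral` is the stack insertion at `(0, 0)` (plumbing).
[cite: tHooft1979Flux, §2 (2.5)–(2.6)] -/
theorem tHooft_factor_eq_finTorusStackTwist [NeZero Ls] (z : G) (x : FinTorusSite Ls Ls Ls Lt)
    (q' : {p : Fin 4 × Fin 4 // p.1 < p.2}) :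
    (if q' = ⟨((0 : Fin 4), (1 : Fin 4)), by decide⟩ ∧ finTorusSiteCoord x (0 : Fin 4) = 0 ∧
        finTorusSiteCoord x (1 : Fin 4) = 0 then z else 1) =
      finTorusStackTwist Ls Lt z (0 : Fin Ls) (0 : Fin Ls) (x, q') := by
  rw [finTorusStackTwist_apply]
  have h0 : finTorusSiteCoord x (0 : Fin 4) = 0 ↔ x.1 = 0 := by
    rw [show finTorusSiteCoord x 0 = (x.1 : ℕ) from rfl, Fin.val_eq_zero_iff]
  have h1 : finTorusSiteCoord x (1 : Fin 4) = 0 ↔ x.2.1 = 0 := by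
    rw [show finTorusSiteCoord x 1 = (x.2.1 : ℕ) from rfl, Fin.val_eq_zero_iff]
  simp only [h0, h1]

/-- **★ Bridge.**  't Hooft's `(0,1)`-twisted partition function of the box `L_s × L_s × L_s × L_t` is `e^{-βN·#plaquettes}` times
the partition function of Wilson's family `W ↦ e^{β Re tr ρ(W)}` twisted by the stack insertion `z·𝟙_{stack(0,0)}` on the plaquette–link
system `finTorusSystem` (the strong-coupling normalisation of arXiv:0707.2179 (6.1)/(6.5)).
[cite: tHooft1979Flux, §2 (2.5)–(2.6)] [cite: Tomboulis2007Confinement, §6.1 eq. (6.1) and §6.2 eq. (6.5)] -/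
theorem twistedPartitionFunctionAniso_eq_mul_Z [NeZero Ls] (β : ℝ) (z : G) :
    twistedPartitionFunctionAniso ρ β Ls Lt z ⟨((0 : Fin 4), (1 : Fin 4)), by decide⟩ =
      Real.exp (-(β * N)) ^ Fintype.card (FinTorusPlaquette Ls Ls Ls Lt) *
        (finTorusSystem Ls Ls Ls Lt G).Z
          (twistFamily (finTorusStackTwist Ls Lt z (0 : Fin Ls) (0 : Fin Ls)) fun _ W => Real.exp (β * ((ρ W).trace).re)) := by
  rw [twistedPartitionFunctionAniso_eq_integral, finTorusSystem_Z, ← integral_const_mul]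
  refine integral_congr_ae (ae_of_all _ fun U => ?_)
  dsimp only
  rw [← Fintype.sum_prod_type' (f := fun (x : FinTorusSite Ls Ls Ls Lt) (q' : {p : Fin 4 × Fin 4 // p.1 < p.2}) =>
      ((N : ℝ) - (ρ ((if q' = ⟨((0 : Fin 4), (1 : Fin 4)), by decide⟩ ∧ finTorusSiteCoord x (0 : Fin 4) = 0 ∧
          finTorusSiteCoord x (1 : Fin 4) = 0 then z else 1) * finTorusPlaquette U x q'.1.1 q'.1.2)).trace.re)),
    exp_neg_mul_sum_eq_pow_mul_prod]
  congr 1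
  refine Finset.prod_congr rfl fun p _ => ?_
  simp only [twistFamily, tHooft_factor_eq_finTorusStackTwist]

omit [TopologicalSpace G] [IsTopologicalGroup G] [CompactSpace G] [MeasurableSpace G] [BorelSpace G] in
/-- No twist: the stack insertion of `z = 1` is trivial. [cite: tHooft1979Flux, §2 (2.6)] -/
theorem finTorusStackTwist_one {n₀ n₁ : ℕ} (n₂ n₃ : ℕ) (a : Fin n₀) (b : Fin n₁) :
    finTorusStackTwist n₂ n₃ (1 : G) a b = fun _ => 1 := by
  funext p
  simp [finTorusStackTwist_apply]

end Bridge

/-! ### The strong-coupling bound, uniform in the transverse extent -/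

section Bound

variable {Ls Lt : ℕ} [SecondCountableTopology G]

/-- **★★ The strong-coupling bound on 't Hooft's twisted partition function of the ANISOTROPIC box, uniform in `L_t`.**  For every
second-countable compact `G`, continuous `ρ : G →* M_N(ℂ)`, central twist `z`, `|β| ≤ 1/(4(N+1)·97²e²)` and every box `L_s³ × L_t`
(`L_s ≥ 1`):
`|ln Z_z(L_s, L_t) - ln Z_1(L_s, L_t)| ≤ 12 · L_s³ L_t · e^{-L_s²}`
(`Z = twistedPartitionFunctionAniso ρ β L_s L_t · (0,1)`): in the convergent polymer expansion only clusters containing a polymer that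
meets all `L_s²` translates of the twisted stack survive, and their number of anchors is `#plaquettes = 6 L_s³ L_t` — the transverse
side `L_t` enters ONLY linearly (Ito–Seiler 2008 Thm 2.2 (1): "uniformly in `L₃, L₄`"; Tomboulis 2007 (6.11)–(6.12); Münster 1981).
[cite: ItoSeiler2008Further, §2 Thm 2.2 (1)] [cite: Tomboulis2007Confinement, §6.2 eqs. (6.10)–(6.12)] -/
theorem abs_log_twistedPartitionFunctionAniso_sub_le [NeZero Ls] (hρ : Continuous ρ) {β : ℝ}
    (hβ : |β| ≤ 1 / (4 * ((N : ℝ) + 1) * ((97 : ℝ) ^ 2 * Real.exp 2))) {z : G} (hz : z ∈ Subgroup.center G) :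
    |Real.log (twistedPartitionFunctionAniso ρ β Ls Lt z ⟨((0 : Fin 4), (1 : Fin 4)), by decide⟩) -
        Real.log (twistedPartitionFunctionAniso ρ β Ls Lt 1 ⟨((0 : Fin 4), (1 : Fin 4)), by decide⟩)| ≤
      12 * ((Ls : ℝ) ^ 3 * Lt) * Real.exp (-((Ls : ℝ) ^ 2)) := by
  set S := finTorusSystem Ls Ls Ls Lt G with hS
  set w : FinTorusPlaquette Ls Ls Ls Lt → G → ℝ := fun _ W => Real.exp (β * ((ρ W).trace).re) with hw
  set t := finTorusStackTwist Ls Lt z (0 : Fin Ls) (0 : Fin Ls) with ht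
  -- smallness
  have hK : (0 : ℝ) < (97 : ℝ) ^ 2 * Real.exp 2 := by positivity
  have hNβ : ((N : ℝ) + 1) * |β| ≤ 1 / (4 * ((97 : ℝ) ^ 2 * Real.exp 2)) := by
    have hden : (0 : ℝ) < 4 * ((N : ℝ) + 1) * ((97 : ℝ) ^ 2 * Real.exp 2) := by positivity
    rw [le_div_iff₀ hden] at hβ
    rw [le_div_iff₀ (by positivity)]
    nlinarith [abs_nonneg β]
  have hNβ' : (N : ℝ) * |β| ≤ ((N : ℝ) + 1) * |β| := by nlinarith [abs_nonneg β]
  have he1 : (1 : ℝ) ≤ Real.exp 2 := Real.one_le_exp (by norm_num)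
  have hNβ1 : (N : ℝ) * |β| ≤ 1 := by
    have : 1 / (4 * ((97 : ℝ) ^ 2 * Real.exp 2)) ≤ 1 := by
      rw [div_le_iff₀ (by positivity)]
      nlinarith
    linarith
  have hε₁ : ∀ (p : FinTorusPlaquette Ls Ls Ls Lt) (W : G), |twistFamily t w p W - 1| ≤ 2 * N * |β| := fun p W =>
    CentralTwist.abs_exp_mul_re_trace_sub_one_le ρ hρ hNβ1 _
  have hε₂ : ∀ (p : FinTorusPlaquette Ls Ls Ls Lt) (W : G), |w p W - 1| ≤ 2 * N * |β| := fun p W =>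
    CentralTwist.abs_exp_mul_re_trace_sub_one_le ρ hρ hNβ1 _
  have hsmall : (((96 : ℕ) : ℝ) + 1) ^ 2 * (Real.exp 2 * (2 * N * |β|)) ≤ 1 / 2 := by
    have h := hNβ
    rw [le_div_iff₀ (by positivity)] at h
    norm_num at h ⊢
    nlinarith [abs_nonneg β, Real.exp_pos 2, hNβ']
  have hw₁ : ∀ p, Measurable (twistFamily t w p) := fun p =>
    (CentralTwist.measurable_exp_mul_re_trace ρ hρ β).comp (measurable_const_mul (t p))
  have hw₂ : ∀ p, Measurable (w p) := fun p => CentralTwist.measurable_exp_mul_re_trace ρ hρ β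
  have hhol : ∀ p, Measurable fun U : FinTorusLink Ls Ls Ls Lt → G => S.hol U p := measurable_finTorusSystem_hol
  have hΔ : ∀ p, (S.nbrs p).card ≤ 96 := card_nbrs_finTorusSystem_le
  have hagree : ∀ X : Finset (FinTorusPlaquette Ls Ls Ls Lt), X.card < Ls ^ 2 →
      S.polymerActivity (twistFamily t w) X = S.polymerActivity w X := fun X hX =>
    polymerActivity_finTorusStackTwist_eq_of_card_lt hz 0 0 w (by rwa [sq] at hX)
  have hmain := S.abs_log_Z_sub_log_Z_le_of_agree hhol hΔ hw₁ hw₂ hε₁ hε₂ hsmall hagree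
  -- the two partition functions
  have hZ₁ : 0 < S.Z (twistFamily t w) := S.Z_pos_of_kpSmall hhol hw₁ hε₁ hsmall
  have hZ₂ : 0 < S.Z w := S.Z_pos_of_kpSmall hhol hw₂ hε₂ hsmall
  have hc : 0 < Real.exp (-(β * N)) ^ Fintype.card (FinTorusPlaquette Ls Ls Ls Lt) := pow_pos (Real.exp_pos _) _
  have h1 : twistedPartitionFunctionAniso ρ β Ls Lt z ⟨((0 : Fin 4), (1 : Fin 4)), by decide⟩ =
      Real.exp (-(β * N)) ^ Fintype.card (FinTorusPlaquette Ls Ls Ls Lt) * S.Z (twistFamily t w) :=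
    twistedPartitionFunctionAniso_eq_mul_Z ρ β z
  have h2 : twistedPartitionFunctionAniso ρ β Ls Lt 1 ⟨((0 : Fin 4), (1 : Fin 4)), by decide⟩ =
      Real.exp (-(β * N)) ^ Fintype.card (FinTorusPlaquette Ls Ls Ls Lt) * S.Z w := by
    rw [twistedPartitionFunctionAniso_eq_mul_Z ρ β (1 : G), finTorusStackTwist_one, twistFamily_one]
  rw [h1, h2, Real.log_mul hc.ne' hZ₁.ne', Real.log_mul hc.ne' hZ₂.ne', add_sub_add_left_eq_sub]
  refine hmain.trans (le_of_eq ?_)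
  rw [card_finTorusPlaquette]
  push_cast
  ring

end Bound

end Literature.MathematicalPhysics.QuantumFieldTheory

end
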